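import Summits.ValiantsHypothesis.ValiantsHypothesis.Theorems.BarrierLeverPartitionMinorsHitByVPMooreBallBall
import Summits.ValiantsHypothesis.ValiantsHypothesis.Theorems.BarrierLeverPartitionMinorsHitByVPOfLowerSets

/-!
# Route BarrierLever — item `PartitionMinorsHitByVP` (stmt-ValiantsHypothesis-19717):
# ALL CO-RANK-ONE MINORS of the partition matrix are hit (`r = 2^h − 1`, every layout)

Helper file (`--supports stmt-ValiantsHypothesis-19717`; cell valiant-natproofs, rung V4, 𝒟-side door (c); prover
seat val-np-p6 gen 6). Definition-free. Closes NO item.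

Item 19717 asks, for every injective layout `(u, w)` of `r` row sets and `r` column sets, for an `f ∈ SmallCircuits`
whose partition minor `[coeff_{x^{u i} y^{w j}} f]` is nonsingular. The FULL matrix (`r = 2^h`) is hit by a diagonal
witness (tree); a minor that deletes ONE row set `U₀` and ONE column set `W₀ ≠ U₀` is NOT hit by any witness with a
diagonal partition matrix (the minor then has a zero row). This file hits ALL of them at once:

* **`partitionMinor_hit_of_card_eq_two_pow_sub_one`** — for `h ≥ 4` and EVERY injective layout with `r = 2^h − 1`
  (both `u` and `w` miss exactly one subset of `Fin h`, arbitrary, any orders) there is `f ∈ SmallCircuits ℂ (h+h) 9`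
  with nonsingular partition minor.

MECHANISM (two landed pieces, no new idea): by val-np-p1 g12's LOWER-SET REDUCTION in explicit form
(`DownCompression.exists_witness_of_lowerSets`, fixed `r`) it suffices to hit the layouts whose row AND column ranges
are lower sets of size `2^h − 1`; the ONLY lower set of that size is «all subsets but the top one» — the Hamming ball
`B([h], h−1)` (`isBall_of_lowerSet_card`); and «ball rows × ball columns, every radius» is this seat's
`ballRowsUniversal_ballColumns` (`…HitByVPMooreBallBall`, the low-order peel of the Moore–ball determinant), turned into a
witness of size `≤ (2h)^5`, degree `≤ 2h` by the additive door; the reduction costs `+6h` size, `+2h` degree, and the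
truncation back to degree `2h` lands in exponent `9` (`DownCompression.size_le_pow`).

WHAT THIS IS NOT: one value of `r` (the largest proper one); `r = 2^h − k`, `k ≥ 2`, needs lower sets that are not
balls (conjecture F_3 / T1 territory); nothing on crux 14610 or VP vs VNP.
-/

set_option linter.dupNamespace false

namespace Summit.ValiantsHypothesis.ValiantsHypothesis.Theorems.BarrierLever.FrobeniusDoor

open Finset MvPolynomial Matrix
open Literature.Barriers.ValiantsHypothesis Literature.Computability.AlgebraicComplexity
open Summit.ValiantsHypothesis.ValiantsHypothesis.Theorems.BarrierLever.AdditiveDoor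
  (truncation_spec degree_partitionExpo_le partitionMinor_hit_of_additive)
open Summit.ValiantsHypothesis.ValiantsHypothesis.Theorems.BarrierLever.DownCompression
  (exists_witness_of_lowerSets size_le_pow)

noncomputable section

/-- **The only lower set of size `2^h − 1` is the ball of radius `h − 1`** (`h ≥ 1`). An injective family of
`2^h − 1` subsets of `Fin h` with lower-set range consists of sets of size `≤ h − 1` and contains every such set. -/
theorem isBall_of_lowerSet_card {h r : ℕ} (h1 : 1 ≤ h) (hr : r = 2 ^ h - 1) (v : Fin r → Finset (Fin h))
    (hv : Function.Injective v) (hlow : IsLowerSet (Set.range v)) :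
    (∀ i, (v i).card ≤ h - 1) ∧ (∀ S : Finset (Fin h), S.card ≤ h - 1 → ∃ i, v i = S) := by
  classical
  have h2h : 2 ≤ 2 ^ h := by
    calc 2 = 2 ^ 1 := by norm_num
      _ ≤ 2 ^ h := Nat.pow_le_pow_right (by norm_num) h1
  -- the top set is not in the range (else the range would be everything)
  have htop : ∀ i, v i ≠ Finset.univ := by
    intro i hi
    have hall : ∀ S : Finset (Fin h), S ∈ Set.range v := fun S =>
      hlow (show S ≤ v i by rw [hi]; exact Finset.subset_univ S) ⟨i, rfl⟩
    have hsurj : Function.Surjective v := fun S => by obtain ⟨j, hj⟩ := hall S; exact ⟨j, hj⟩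
    have hcard := Fintype.card_le_of_surjective v hsurj
    rw [Fintype.card_fin, Fintype.card_finset, Fintype.card_fin] at hcard
    omega
  refine ⟨fun i => ?_, fun S hS => ?_⟩
  · have hlt : (v i).card < h := by
      have := Finset.card_lt_card (Finset.ssubset_univ_iff.mpr (htop i))
      rwa [Finset.card_univ, Fintype.card_fin] at this
    omega
  · have hS' : S ≠ Finset.univ := by
      intro hSu
      rw [hSu, Finset.card_univ, Fintype.card_fin] at hS
      omega
    by_contra hnot
    push Not at hnot
    -- the range avoids `univ` and `S`: too few sets remain
    have hsub : Finset.univ.image v ⊆ ((Finset.univ : Finset (Finset (Fin h))).erase Finset.univ).erase S := by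
      intro T hT
      obtain ⟨i, -, rfl⟩ := Finset.mem_image.mp hT
      exact Finset.mem_erase.mpr ⟨hnot i, Finset.mem_erase.mpr ⟨htop i, Finset.mem_univ _⟩⟩
    have hcard := Finset.card_le_card hsub
    rw [Finset.card_image_of_injective _ hv, Finset.card_univ, Fintype.card_fin,
      Finset.card_erase_of_mem (Finset.mem_erase.mpr ⟨hS', Finset.mem_univ _⟩),
      Finset.card_erase_of_mem (Finset.mem_univ _), Finset.card_univ, Fintype.card_finset, Fintype.card_fin] at hcard
    omega

/-- **ALL CO-RANK-ONE PARTITION MINORS ARE HIT.** `h ≥ 4`, `r = 2^h − 1`: for EVERY pair of injective families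
`u, w : Fin r → Finset (Fin h)` (each missing exactly one subset, in any order) some `f ∈ SmallCircuits ℂ (h+h) 9` has a
nonsingular partition minor `[coeff_{x^{u i} y^{w j}} f]_{i,j}`. -/
theorem partitionMinor_hit_of_card_eq_two_pow_sub_one {h r : ℕ} (hh : 4 ≤ h) (hr : r = 2 ^ h - 1)
    (u w : Fin r → Finset (Fin h)) (hu : Function.Injective u) (hw : Function.Injective w) :
    ∃ f ∈ SmallCircuits ℂ (h + h) 9,
      (Matrix.of fun i j : Fin r => MvPolynomial.coeff
        (∑ a ∈ u i, Finsupp.single (Fin.castAdd h a) 1 +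
          ∑ c ∈ w j, Finsupp.single (Fin.natAdd h c) 1) f).det ≠ 0 := by
  -- the lower-set pairs of this size are ball × ball, hit by the additive witness of `ballRowsUniversal_ballColumns`
  have hyp : ∀ v w' : Fin r → Finset (Fin h), Function.Injective v → Function.Injective w' →
      IsLowerSet (Set.range v) → IsLowerSet (Set.range w') →
      ∃ f : MvPolynomial (Fin (h + h)) ℂ, complexity f ≤ (h + h) ^ 5 ∧ f.totalDegree ≤ h + h ∧
        (Matrix.of fun i j : Fin r => MvPolynomial.coeff
          (∑ a ∈ v i, Finsupp.single (Fin.castAdd h a) 1 +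
            ∑ c ∈ w' j, Finsupp.single (Fin.natAdd h c) 1) f).det ≠ 0 := by
    intro v w' hv hw' hlv hlw'
    obtain ⟨hvs, hva⟩ := isBall_of_lowerSet_card (by omega) hr v hv hlv
    obtain ⟨hws, hwa⟩ := isBall_of_lowerSet_card (by omega) hr w' hw' hlw'
    obtain ⟨ω₀, ω, hdet⟩ := ballRowsUniversal_ballColumns v w' hv hw' hvs hva hws hwa
    obtain ⟨f, hfd, hfs, hf⟩ := partitionMinor_hit_of_additive h v w' ω₀ ω hdet
    refine ⟨f, hfs.trans ?_, hfd, hf⟩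
    -- `(2h+2)²(3h²+6h+1) + 2h+1 ≤ (2h)^5` for `h ≥ 2`
    have h2 : 2 ≤ h := by omega
    have key : (h + h + 2) ^ 2 * (3 * h * h + 6 * h + 1) + (h + h + 1) ≤ (h + h) ^ 5 := by
      have e1 : (h + h + 2) ^ 2 ≤ 9 * h ^ 2 := by nlinarith
      have e2 : 3 * h * h + 6 * h + 1 ≤ 7 * h ^ 2 := by nlinarith
      have e3 : h + h + 1 ≤ h ^ 5 := by
        calc h + h + 1 ≤ 3 * h := by omega
          _ ≤ h * h := by nlinarith
          _ ≤ h ^ 5 := by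
            calc h * h = h ^ 2 := by ring
              _ ≤ h ^ 5 := Nat.pow_le_pow_right (by omega) (by norm_num)
      calc (h + h + 2) ^ 2 * (3 * h * h + 6 * h + 1) + (h + h + 1)
          ≤ 9 * h ^ 2 * (7 * h ^ 2) + h ^ 5 := Nat.add_le_add (Nat.mul_le_mul e1 e2) e3
        _ = 63 * h ^ 4 + h ^ 5 := by ring
        _ ≤ 16 * h * h ^ 4 + 16 * h ^ 5 := by nlinarith
        _ = (h + h) ^ 5 := by ring
    exact key
  obtain ⟨g, hgs, hgd, hg⟩ := exists_witness_of_lowerSets ((h + h) ^ 5) (h + h) hyp u w hu hw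
  obtain ⟨hdeg, hcoeff, hsize⟩ := truncation_spec g (h + h)
  refine ⟨∑ k ∈ Finset.range (h + h + 1), homogeneousComponent k g, ⟨hdeg, ?_⟩, ?_⟩
  · calc complexity (∑ k ∈ Finset.range (h + h + 1), homogeneousComponent k g)
        ≤ (h + h + 2) ^ 2 * complexity g + (h + h + 1) := hsize
      _ ≤ (h + h + 2) ^ 2 * ((h + h) ^ 5 + 6 * h) + (h + h + 1) := by gcongr
      _ ≤ (h + h) ^ (5 + 4) := size_le_pow h 5 hh
  · have hmat : (Matrix.of fun i j : Fin r => MvPolynomial.coeff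
        (∑ a ∈ u i, Finsupp.single (Fin.castAdd h a) 1 +
          ∑ c ∈ w j, Finsupp.single (Fin.natAdd h c) 1)
        (∑ k ∈ Finset.range (h + h + 1), homogeneousComponent k g)) =
        Matrix.of fun i j : Fin r => MvPolynomial.coeff
          (∑ a ∈ u i, Finsupp.single (Fin.castAdd h a) 1 +
            ∑ c ∈ w j, Finsupp.single (Fin.natAdd h c) 1) g := by
      ext i j
      rw [Matrix.of_apply, Matrix.of_apply, hcoeff _ (degree_partitionExpo_le _ _)]
    rw [hmat]
    exact hg

end

end Summit.ValiantsHypothesis.ValiantsHypothesis.Theorems.BarrierLever.FrobeniusDoor
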